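import Summits.QuantumFields.YangMills.Theorems.BalabanUVNodesN15BumpLattice
import Summits.QuantumFields.YangMills.Theorems.BalabanUVNodesN15TwoSpacingGluingNeumannCoverRows
import HarnessLib

/-!
# THE SMOOTH CUT-OFF WITH A PLATEAU, V: THE BUMP AT THE COVER — every one-grid letter, cut identity and plateau identity of the sampled bump `χ̃_k = bcube (2q) ξ R k`
# READ ON dag-n15-c's CUBE COVER OF THE DOUBLED TORUS (FILE 66: `ξ_ν = coverXi M n w ν`, bond shifts `bshiftEquiv M n`, period `K = 2q`, step `s = (nw)⁻¹`; FILE 72: side-`S`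
# cubes `□_k` at `coverCorner M w q m₀ k` with their indicator cut `χ_k = chiCube M n (coverCorner M w q m₀ k) S`), AT EVERY SPACING `n`
# (dag-n15-w4 g4, width seat on N15 = NE2; the cover-level producer of files 44∕45∕47∕48's bump rows for the (r3) assembly)

Cell `pub-ymgap`, seat `pub-ymgap-dag-n15-w4` (director №399 (3a) width; HUMAN RULING D-0062), generation 4.  `bears_on: R4∕N15 · K3⁸ SpineGivenEndpointR13SepCoPHV
(stmt-QuantumFields-27366)`.  Filed `--supports stmt-QuantumFields-27366 --as helper` — COUNT-NEUTRAL.  Theorems only (0 `def`, 0 `sorry`).  Imports BY NAME this seat's FILE II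
`…N15BumpLattice` (g3: `bcube` and its generic-carrier letters under FILE 61's `hξ`) and dag-n15-c FILE 72 `…TwoSpacingGluingNeumannCoverRows` (through it
FILES 66∕67: `coverXi`, `coverCorner`, `coverXi_shift`, `coverXi_offset`, `coverXi_fine_sub_eq`, `val_sub_up_le_of_step`, `blockOf_mem_cubeBlocks_iff`; dag-n15-a N-IIIb `chiCube`,
`cubeBlocks`).  Nothing in the tree is modified.

WHY.  dag-n15-w3 files 44∕45 (`hasMaj_glueInv_smoothCutDressed`, `hasMaj_idef_glueInv_smoothCutDressed`) and g5's gauged capstones 47∕48 display per cube a smooth cut `χ̃_k` through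
`hχt`, `hdχt∕hdχtb ≤ c_t`, the ten cut identities `hsub hχ hs hsb hs2 hsb2 hdd hddb hdd2 hddb2` against the cube's input cut `χ_k`, the plateau identity `hL`, and the two-grid fits
`hfitχ hfit₁ hfit₁b hfit₂ hfit₂b`; dag-n15-a g23's (r3) census (INBOX 2026-08-28T14:49:07Z) reads them off this seat's g3 FILES II∕III — which are stated on ANY carrier with the
coordinate data `hξ hξ′ hoff` DISPLAYED.  The (r3) knit is instantiated at dag-n15-c's cover (FILE 66) with dag-n15-a's cube indicator `chiCube` as the input cut; THIS FILE reads every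
bump row there, BY NAME, the way FILES 67∕72∕74 read the partition's: the coordinate data are FILE 66 `coverXi_shift` and FILE 67 `coverXi_offset`, the cut hypothesis of FILE II §3
is DISCHARGED for `χ_k = chiCube M n (coverCorner M w q m₀ k) S` by a radius-`ρ` edition of FILE 66's support window (§2), and the constants come out in the cover's parameters:
`c_t = π∕w`, `oχ = oχ₁ = π(d+1)∕(L^k w)` (`hfit₁b`: twice that), `oχ₂ = w⁻¹(L^k w)⁻¹(32π⁴ + π²(d+1))`, plateau radius `R ≥ 1 + (nw)⁻¹` (e.g. `R ≥ 2`), window `Rw ≤ m₀`,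
`m₀ + (R+2)w + 1 ≤ S ≤ 2qw`, two-grid side conditions `0 ≤ R`, `2R + 4 ≤ 2q`.
* §1 `two_mul_q_pos_of_cover`, `abs_bcube_cover_le_one` (`hχt`), ★ `abs_fgrad_bcube_cover_le` ∕ `abs_bgrad_bcube_cover_le` (`hdχt`∕`hdχtb ≤ π∕w`, every spacing `n`).
* §2 ★★ `val_sub_up_of_abs_cenRep_lt` (the radius-`ρ` window in relative fine coordinates), ★★ `chiCube_coverCorner_eq_one_of_near_bbox` (FILE II §3's cut hypothesis for the cube's own
  indicator), ★ `blockOf_mem_cubeBlocks_of_bcube_cover_ne_zero` (`supp χ̃_k ⊂` blocks of `□_k`: the `hSχ`-type row for the bump).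
* §3 the ten cut identities at the cover: `bcube_cover_cut`, `cut_bcube_cover`, `bcube_cover_comp_shift_cut`, `cut_bcube_cover_comp_shift`, `bcube_cover_comp_shift_symm_cut`,
  `cut_bcube_cover_comp_shift_symm`, `fgrad_bcube_cover_cut`, `cut_fgrad_bcube_cover`, `bgrad_bcube_cover_cut`, `cut_bgrad_bcube_cover`.
* §4 ★★ `bcube_cover_eq_one_of_coverH_ne_zero` (+ `_two`), ★★★ `mulOp_coverH_comp_lapOp_comp_one_sub_bcube_cover` (`hL` given the displayed `W`-locality; + `_two`),
  ★★ `mulOp_coverH_comp_lapOp_mulOp_comp_one_sub_bcube_cover` (hypothesis-free for a multiplication operator `W = M_v`).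
* the two-grid fits `hfitχ hfit₁ hfit₁b hfit₂ hfit₂b` at the cover's two spacings are the sequel `…N15BumpCoverTwoGrid` (FILE III at FILE 66∕67's `hξ hξ′ hoff`).

HONEST FRAMING ∕ LIMITS.  Finite lattice geometry on `(ℤ∕2qwn)^{d+1}` (casts, `round`, `ZMod.val`) + one-line instances of LANDED FILES II∕III; no operator estimate; the knit's
parameters (`R`, `m₀`, `S`, `w`, `q`, `L`, `k`, `r`) are displayed, not chosen; [B6] (2.36)–(2.37) p.229, (2.91) p.239 and [B9] (3.62)–(3.65) pp.402–403, Thm 3.14 pp.426–427 are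
SHAPES ∕ the difference template only — nothing of [B5]∕[B6]∕[B9] asserted.  `U ≡ 1` doubled-cube torus MODEL geometry of dag-n15-a∕dag-n15-c.  NE2⁺ NOT PRINTED, NOT proved; N15
NOT discharged; counts of record UNMOVED (typed 28∕28 · discharged 5∕27); one finite 𝕋⁴ at fixed ε — NOT infinite volume, NOT OS on ℝ⁴, NOT a mass gap, NOT Clay; R4 closes the
conditional finite-𝕋⁴ rung `BalabanLadder.UV` only.  Restate-immune (no Theses import).
-/

noncomputable section

namespace Summit.QuantumFields.YangMills.BalabanUVNodes.N15.Gluing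

open Real
open Literature.MathematicalPhysics.QuantumFieldTheory.Balaban1983to89
open Literature.MathematicalPhysics.QuantumFieldTheory.Balaban1983to89.B5Prop11Plancherel (Tor fine unitVec)
open Literature.MathematicalPhysics.QuantumFieldTheory.Balaban1983to89.B5Block118 (up upHom_intCast)
open Literature.MathematicalPhysics.QuantumFieldTheory.Balaban1983to89.B6Prop26Gluing (mulOp mulOp_apply)
open Literature.MathematicalPhysics.QuantumFieldTheory.King1986.Torus (blockOf val_blockOf)
open Summit.QuantumFields.YangMills.BalabanUVNodes.N15.BackgroundLayer (fgrad fgradAdj bgrad)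
open Summit.QuantumFields.YangMills.BalabanUVNodes.N15.VectorPiece (bshiftEquiv bshiftEquiv_apply bshiftEquiv_symm_apply kingPrV)
open Summit.QuantumFields.YangMills.BalabanUVNodes.N15.TwoGrid (cubeBlocks mem_cubeBlocks chiCube)

variable {d : ℕ}

/-! ## §1 One grid: size and the difference-quotient letter `c_t = π∕w` -/

section OneGrid

variable {M : Fin (d + 1) → ℕ} [∀ μ, NeZero (M μ)] {n w q : ℕ} [NeZero n] (R : ℝ)

omit [NeZero n] in
/-- the period `K = 2q` of the cover is positive (the torus `M_ν = 2qw` is nonempty). [folklore] -/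
theorem two_mul_q_pos_of_cover (hM : ∀ ν, M ν = 2 * q * w) : 0 < 2 * q := by
  rcases Nat.eq_zero_or_pos q with h | h
  · subst h; exact absurd (hM 0) (by have := NeZero.ne (M 0); simpa using this)
  · omega

omit [∀ μ, NeZero (M μ)] [NeZero n] in
/-- `|χ̃_k| ≤ 1` on the cover (files 44∕45's `hχt`; FILE II `abs_bcube_le_one`). [folklore] -/
theorem abs_bcube_cover_le_one (k : Fin (d + 1) → ZMod (2 * q)) (x : Tor (fine n M) × Fin (d + 1)) : |bcube (2 * q) (coverXi M n w) R k x| ≤ 1 :=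
  abs_bcube_le_one _ _ _ k x

/-- ★ **`hdχt` AT THE COVER**: `|∇_μ χ̃_k| ≤ π∕w` at every spacing `n` (FILE II `abs_fgrad_bcube_le` with FILE 66 `coverXi_shift`: `|n|·π·(nw)⁻¹ = π∕w`).
[cite: Balaban1985BackgroundPropagators, (3.62)–(3.65) pp.402–403 («|∂χ̃| ≤ O(1)M⁻¹»: shape)] -/
theorem abs_fgrad_bcube_cover_le (hM : ∀ ν, M ν = 2 * q * w) (hw : 0 < w) (k : Fin (d + 1) → ZMod (2 * q)) (μ : Fin (d + 1)) (x : Tor (fine n M) × Fin (d + 1)) :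
    |fgrad (n : ℝ) (bshiftEquiv M n μ) (bcube (2 * q) (coverXi M n w) R k) x| ≤ π / w := by
  have hn : 0 < n := Nat.pos_of_ne_zero (NeZero.ne n)
  have h := abs_fgrad_bcube_le (2 * q) (coverXi M n w) R (bshiftEquiv M n) (two_mul_q_pos_of_cover hM) (coverXi_shift hM hw) (n : ℝ) k μ x
  refine h.trans (le_of_eq ?_)
  rw [abs_of_nonneg (by positivity : (0 : ℝ) ≤ n), abs_of_nonneg (by positivity : (0 : ℝ) ≤ ((n : ℝ) * w)⁻¹)]
  field_simp

/-- ★ **`hdχtb` AT THE COVER**: `|∇⁻_μ χ̃_k| ≤ π∕w` at every spacing `n` (FILE II `abs_bgrad_bcube_le`). [cite: Balaban1985BackgroundPropagators, (3.62)–(3.65) pp.402–403 (shape)] -/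
theorem abs_bgrad_bcube_cover_le (hM : ∀ ν, M ν = 2 * q * w) (hw : 0 < w) (k : Fin (d + 1) → ZMod (2 * q)) (μ : Fin (d + 1)) (x : Tor (fine n M) × Fin (d + 1)) :
    |bgrad (n : ℝ) (bshiftEquiv M n μ) (bcube (2 * q) (coverXi M n w) R k) x| ≤ π / w := by
  have hn : 0 < n := Nat.pos_of_ne_zero (NeZero.ne n)
  have h := abs_bgrad_bcube_le (2 * q) (coverXi M n w) R (bshiftEquiv M n) (two_mul_q_pos_of_cover hM) (coverXi_shift hM hw) (n : ℝ) k μ x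
  refine h.trans (le_of_eq ?_)
  rw [abs_of_nonneg (by positivity : (0 : ℝ) ≤ n), abs_of_nonneg (by positivity : (0 : ℝ) ≤ ((n : ℝ) * w)⁻¹)]
  field_simp

end OneGrid

/-! ## §2 The window: the open `ρ`-box of `χ̃_k` in relative fine coordinates; the cube's indicator is an admissible input cut -/

section Window

variable {M : Fin (d + 1) → ℕ} [∀ μ, NeZero (M μ)] {n w q m₀ S : ℕ} [NeZero n] (R : ℝ)

/-- ★★ **THE RADIUS-`ρ` WINDOW IN RELATIVE FINE COORDINATES** (radius-`ρ` edition of FILE 66 `val_sub_up_of_abs_cenRep_lt_one`): if `|v_{2q}(ξ_ν(b) − k_ν)| < ρ` then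
`n(m₀ + w) − ρnw < val((b − n·c(k))_ν) < n(m₀ + w) + ρnw` — the centre of `h_k`'s window sits `m₀ + w` blocks above the cube's corner; window conditions `(ρ − 1)w ≤ m₀`
(no wrap below) and `m₀ + w + ρw ≤ 2qw` (no wrap above). [cite: Balaban1984PropagatorsII, (2.36)–(2.37) p.229 (supp ⊂ □: shape)] -/
theorem val_sub_up_of_abs_cenRep_lt (hM : ∀ ν, M ν = 2 * q * w) (hw : 0 < w) {ρ : ℝ} (hlo : (ρ - 1) * w ≤ m₀) (hhi : (m₀ : ℝ) + w + ρ * w ≤ 2 * q * w)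
    {k : Fin (d + 1) → ZMod (2 * q)} {b : Tor (fine n M) × Fin (d + 1)} {ν : Fin (d + 1)} (hc : |cenRep (2 * q) (coverXi M n w ν b - ((k ν).val : ℝ))| < ρ) :
    (n : ℝ) * ((m₀ : ℝ) + w) - ρ * ((n : ℝ) * w) < (((b.1 - up n M (coverCorner M w q m₀ k)) ν).val : ℝ) ∧
      (((b.1 - up n M (coverCorner M w q m₀ k)) ν).val : ℝ) < (n : ℝ) * ((m₀ : ℝ) + w) + ρ * ((n : ℝ) * w) := by
  have hn : 0 < n := Nat.pos_of_ne_zero (NeZero.ne n)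
  have hnr : (0 : ℝ) < n := by exact_mod_cast hn
  have hnw : (0 : ℝ) < (n : ℝ) * w := by positivity
  have hN : fine n M ν = n * (2 * q * w) := by show n * M ν = _; rw [hM ν]
  haveI : NeZero (fine n M ν) := ⟨by rw [hN]; have := two_mul_q_pos_of_cover hM; positivity⟩
  rw [Pi.sub_apply]
  -- the open-box condition in the `ξ`-coordinates
  unfold cenRep coverXi at hc
  set t : ℕ := (b.1 ν).val with ht
  set kv : ℕ := (k ν).val with hkv
  set R₀ : ℤ := round (((t : ℝ) / ((n : ℝ) * w) - (kv : ℝ)) / ((2 * q : ℕ) : ℝ)) with hR₀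
  -- real form: |t − nw·kv − N·R₀| < ρ·nw
  have hreal : |(t : ℝ) - (n : ℝ) * w * kv - (n : ℝ) * (2 * q * w) * R₀| < ρ * ((n : ℝ) * w) := by
    have hne : (n : ℝ) * w ≠ 0 := hnw.ne'
    calc |(t : ℝ) - (n : ℝ) * w * kv - (n : ℝ) * (2 * q * w) * R₀|
        = |((t : ℝ) / ((n : ℝ) * w) - (kv : ℝ) - ((2 * q : ℕ) : ℝ) * (R₀ : ℝ)) * ((n : ℝ) * w)| := by
          congr 1; push_cast; field_simp
      _ = |(t : ℝ) / ((n : ℝ) * w) - (kv : ℝ) - ((2 * q : ℕ) : ℝ) * (R₀ : ℝ)| * ((n : ℝ) * w) := by rw [abs_mul, abs_of_pos hnw]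
      _ < ρ * ((n : ℝ) * w) := mul_lt_mul_of_pos_right hc hnw
  -- the relative coordinate is the cast of `v := t − n·c₀ − N·R₀`
  set v : ℤ := (t : ℤ) - (n : ℤ) * ((w : ℤ) * kv - w - m₀) - (n : ℤ) * (2 * q * w) * R₀ with hv
  have hvR : (v : ℝ) = ((t : ℝ) - (n : ℝ) * w * kv - (n : ℝ) * (2 * q * w) * R₀) + (n : ℝ) * ((m₀ : ℝ) + w) := by rw [hv]; push_cast; ring
  have hvlo : (n : ℝ) * ((m₀ : ℝ) + w) - ρ * ((n : ℝ) * w) < (v : ℝ) := by rw [hvR]; linarith [(abs_lt.mp hreal).1]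
  have hvhi : (v : ℝ) < (n : ℝ) * ((m₀ : ℝ) + w) + ρ * ((n : ℝ) * w) := by rw [hvR]; linarith [(abs_lt.mp hreal).2]
  have hv0 : 0 ≤ v := by
    have h0 : (0 : ℝ) ≤ (n : ℝ) * ((m₀ : ℝ) + w) - ρ * ((n : ℝ) * w) := by
      have e : (n : ℝ) * ((m₀ : ℝ) + w) - ρ * ((n : ℝ) * w) = (n : ℝ) * ((m₀ : ℝ) - (ρ - 1) * w) := by ring
      rw [e]; exact mul_nonneg hnr.le (by linarith)
    have : (0 : ℝ) < (v : ℝ) := h0.trans_lt hvlo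
    exact_mod_cast this.le
  have hvN : v < (fine n M ν : ℕ) := by
    have h1 : (v : ℝ) < (n : ℝ) * (2 * q * w) := by
      have := mul_le_mul_of_nonneg_left hhi hnr.le
      nlinarith
    have h2 : (v : ℝ) < ((fine n M ν : ℕ) : ℝ) := by rw [hN]; push_cast; linarith
    exact_mod_cast h2
  have hcast : b.1 ν - up n M (coverCorner M w q m₀ k) ν = ((v : ℤ) : ZMod (fine n M ν)) := by
    rw [sub_up_coverCorner_eq, hv, ← ht, ← hkv]
    have hNz : (n : ZMod (fine n M ν)) * (2 * (q : ZMod (fine n M ν)) * (w : ZMod (fine n M ν))) = 0 := by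
      have h1 : (((fine n M ν : ℕ)) : ZMod (fine n M ν)) = 0 := ZMod.natCast_self _
      have h2 : (((fine n M ν : ℕ)) : ZMod (fine n M ν)) = (n : ZMod (fine n M ν)) * (2 * (q : ZMod (fine n M ν)) * (w : ZMod (fine n M ν))) := by
        rw [hN]; push_cast; ring
      rw [← h2, h1]
    push_cast
    linear_combination (R₀ : ZMod (fine n M ν)) * hNz
  have hval : (((b.1 ν - up n M (coverCorner M w q m₀ k) ν).val : ℤ)) = v := by rw [hcast, ZMod.val_intCast, Int.emod_eq_of_lt hv0 hvN]
  have hvalR : (((b.1 ν - up n M (coverCorner M w q m₀ k) ν).val : ℝ)) = (v : ℝ) := by exact_mod_cast hval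
  rw [hvalR]
  exact ⟨hvlo, hvhi⟩

/-- ★★ **THE CUBE's INDICATOR IS AN ADMISSIBLE INPUT CUT FOR `χ̃_k`** (FILE II §3's hypothesis `hχ` for `χ = chiCube M n (c k) S`): whenever `x`, `x + e_μ` or `x − e_μ` lies in the
open `(R+1)`-box `{∀ν, |v_{2q}(ξ_ν − k_ν)| < R + 1}` of the bump, the block of `x` is a block of `□_k`.  Window: `Rw ≤ m₀`, `m₀ + w + (R+1)w + 1 ≤ S ≤ 2qw`.
[cite: Balaban1984PropagatorsII, (2.37) p.229 (shape); Balaban1985BackgroundPropagators, (3.62)–(3.65) pp.402–403 (the enlarged cube: shape)] -/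
theorem chiCube_coverCorner_eq_one_of_near_bbox (hM : ∀ ν, M ν = 2 * q * w) (hw : 0 < w) (hlo : R * w ≤ m₀) (hhi : (m₀ : ℝ) + w + (R + 1) * w + 1 ≤ S) (hS : S ≤ 2 * q * w)
    (μ : Fin (d + 1)) (k : Fin (d + 1) → ZMod (2 * q)) (x : Tor (fine n M) × Fin (d + 1))
    (hx : ∃ x₀ : Tor (fine n M) × Fin (d + 1), (x₀ = x ∨ x₀ = bshiftEquiv M n μ x ∨ x₀ = (bshiftEquiv M n μ).symm x) ∧
      ∀ ν, |cenRep (2 * q) (coverXi M n w ν x₀ - ((k ν).val : ℝ))| < R + 1) :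
    chiCube M n (coverCorner M w q m₀ k) S x = 1 := by
  have hn : 1 ≤ n := Nat.one_le_iff_ne_zero.mpr (NeZero.ne n)
  have hnr : (0 : ℝ) < n := by exact_mod_cast hn
  have hSr : (S : ℝ) ≤ 2 * q * w := by exact_mod_cast hS
  obtain ⟨x₀, hx₀, hc⟩ := hx
  have hwin := fun ν => val_sub_up_of_abs_cenRep_lt (n := n) (m₀ := m₀) hM hw (ρ := R + 1) (by linarith) (by linarith) (hc ν)
  have hmem : blockOf n M x.1 ∈ cubeBlocks M (coverCorner M w q m₀ k) S := by
    rw [blockOf_mem_cubeBlocks_iff]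
    intro ν
    have hN : fine n M ν = n * (2 * q * w) := by show n * M ν = _; rw [hM ν]
    obtain ⟨hlo', hhi'⟩ := hwin ν
    -- no wrap and room for one step: `val(x₀) + n + 1 ≤ Sn`
    have hup : ((x₀.1 - up n M (coverCorner M w q m₀ k)) ν).val + n < S * n := by
      have h2 : (n : ℝ) * ((m₀ : ℝ) + w) + (R + 1) * ((n : ℝ) * w) + n ≤ (S : ℝ) * n := by
        have e : (n : ℝ) * ((m₀ : ℝ) + w + (R + 1) * w + 1) = (n : ℝ) * ((m₀ : ℝ) + w) + (R + 1) * ((n : ℝ) * w) + n := by ring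
        have := mul_le_mul_of_nonneg_left hhi hnr.le
        rw [e] at this; linarith
      have h3 : ((((x₀.1 - up n M (coverCorner M w q m₀ k)) ν).val + n : ℕ) : ℝ) < ((S * n : ℕ) : ℝ) := by push_cast; linarith
      exact_mod_cast h3
    have h1' : 1 ≤ ((x₀.1 - up n M (coverCorner M w q m₀ k)) ν).val := by
      have e : (n : ℝ) * ((m₀ : ℝ) + w) - (R + 1) * ((n : ℝ) * w) = (n : ℝ) * ((m₀ : ℝ) - R * w) := by ring
      have h0 : (0 : ℝ) ≤ (n : ℝ) * ((m₀ : ℝ) + w) - (R + 1) * ((n : ℝ) * w) := by rw [e]; exact mul_nonneg hnr.le (by linarith)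
      have : (0 : ℝ) < (((x₀.1 - up n M (coverCorner M w q m₀ k)) ν).val : ℝ) := h0.trans_lt hlo'
      have : 0 < ((x₀.1 - up n M (coverCorner M w q m₀ k)) ν).val := by exact_mod_cast this
      omega
    have hSn : S * n ≤ fine n M ν := by rw [hN, Nat.mul_comm n]; exact Nat.mul_le_mul_right _ hS
    have h2' : ((x₀.1 - up n M (coverCorner M w q m₀ k)) ν).val + 2 ≤ fine n M ν := by omega
    have hstep := val_sub_up_le_of_step μ hx₀ ν h1' h2'
    omega
  unfold chiCube
  rw [if_pos hmem]

/-- ★ **`supp χ̃_k ⊂` THE BLOCKS OF `□_k`** (the `hSχ`-type row for the bump; case `x₀ = x` of the above): `χ̃_k(b) ≠ 0 ⟹ B(b) ∈ cubeBlocks (c k) S`.  Same window.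
[cite: Balaban1985BackgroundPropagators, (3.62)–(3.65) pp.402–403 (shape)] -/
theorem blockOf_mem_cubeBlocks_of_bcube_cover_ne_zero (hM : ∀ ν, M ν = 2 * q * w) (hw : 0 < w) (hlo : R * w ≤ m₀) (hhi : (m₀ : ℝ) + w + (R + 1) * w + 1 ≤ S) (hS : S ≤ 2 * q * w)
    {k : Fin (d + 1) → ZMod (2 * q)} {b : Tor (fine n M) × Fin (d + 1)} (hb : bcube (2 * q) (coverXi M n w) R k b ≠ 0) :
    blockOf n M b.1 ∈ cubeBlocks M (coverCorner M w q m₀ k) S := by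
  have h := chiCube_coverCorner_eq_one_of_near_bbox R hM hw hlo hhi hS 0 k b ⟨b, Or.inl rfl, abs_cenRep_lt_of_bcube_ne_zero (2 * q) (coverXi M n w) R hb⟩
  unfold chiCube at h
  by_contra hne
  rw [if_neg hne] at h
  exact zero_ne_one h

end Window

/-! ## §3 The ten cut identities against the cube's indicator -/

section Cut

variable {M : Fin (d + 1) → ℕ} [∀ μ, NeZero (M μ)] {n w q m₀ S : ℕ} [NeZero n] (R : ℝ)

/-- ★★ `M_{χ̃_k}∘M_{χ_k} = M_{χ̃_k}` at the cover (files 44∕45's `hsub`; FILE II `bcube_cut` on §2's window). [cite: Balaban1985BackgroundPropagators, (3.62)–(3.65) pp.402–403 (shape)] -/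
theorem bcube_cover_cut (hM : ∀ ν, M ν = 2 * q * w) (hw : 0 < w) (hlo : R * w ≤ m₀) (hhi : (m₀ : ℝ) + w + (R + 1) * w + 1 ≤ S) (hS : S ≤ 2 * q * w) (k : Fin (d + 1) → ZMod (2 * q)) :
    mulOp (bcube (2 * q) (coverXi M n w) R k) ∘ₗ mulOp (chiCube M n (coverCorner M w q m₀ k) S) = mulOp (bcube (2 * q) (coverXi M n w) R k) :=
  bcube_cut (2 * q) (coverXi M n w) R (bshiftEquiv M n) 0 (chiCube_coverCorner_eq_one_of_near_bbox R hM hw hlo hhi hS 0 k)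

/-- ★★ `M_{χ_k}∘M_{χ̃_k} = M_{χ̃_k}` at the cover (files 44∕45's `hχ`; FILE II `cut_bcube`). [folklore] -/
theorem cut_bcube_cover (hM : ∀ ν, M ν = 2 * q * w) (hw : 0 < w) (hlo : R * w ≤ m₀) (hhi : (m₀ : ℝ) + w + (R + 1) * w + 1 ≤ S) (hS : S ≤ 2 * q * w) (k : Fin (d + 1) → ZMod (2 * q)) :
    mulOp (chiCube M n (coverCorner M w q m₀ k) S) ∘ₗ mulOp (bcube (2 * q) (coverXi M n w) R k) = mulOp (bcube (2 * q) (coverXi M n w) R k) :=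
  cut_bcube (2 * q) (coverXi M n w) R (bshiftEquiv M n) 0 (chiCube_coverCorner_eq_one_of_near_bbox R hM hw hlo hhi hS 0 k)

/-- ★★ `M_{χ̃_k∘e_μ}∘M_{χ_k} = M_{χ̃_k∘e_μ}` at the cover (files 44∕45's `hs`; FILE II `bcube_comp_shift_cut`). [folklore] -/
theorem bcube_cover_comp_shift_cut (hM : ∀ ν, M ν = 2 * q * w) (hw : 0 < w) (hlo : R * w ≤ m₀) (hhi : (m₀ : ℝ) + w + (R + 1) * w + 1 ≤ S) (hS : S ≤ 2 * q * w)
    (k : Fin (d + 1) → ZMod (2 * q)) (μ : Fin (d + 1)) :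
    mulOp (bcube (2 * q) (coverXi M n w) R k ∘ bshiftEquiv M n μ) ∘ₗ mulOp (chiCube M n (coverCorner M w q m₀ k) S) = mulOp (bcube (2 * q) (coverXi M n w) R k ∘ bshiftEquiv M n μ) :=
  bcube_comp_shift_cut (2 * q) (coverXi M n w) R (bshiftEquiv M n) μ (chiCube_coverCorner_eq_one_of_near_bbox R hM hw hlo hhi hS μ k)

/-- ★★ `M_{χ_k}∘M_{χ̃_k∘e_μ} = M_{χ̃_k∘e_μ}` at the cover (file 45's `hs2`; FILE II `cut_bcube_comp_shift`). [folklore] -/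
theorem cut_bcube_cover_comp_shift (hM : ∀ ν, M ν = 2 * q * w) (hw : 0 < w) (hlo : R * w ≤ m₀) (hhi : (m₀ : ℝ) + w + (R + 1) * w + 1 ≤ S) (hS : S ≤ 2 * q * w)
    (k : Fin (d + 1) → ZMod (2 * q)) (μ : Fin (d + 1)) :
    mulOp (chiCube M n (coverCorner M w q m₀ k) S) ∘ₗ mulOp (bcube (2 * q) (coverXi M n w) R k ∘ bshiftEquiv M n μ) = mulOp (bcube (2 * q) (coverXi M n w) R k ∘ bshiftEquiv M n μ) :=
  cut_bcube_comp_shift (2 * q) (coverXi M n w) R (bshiftEquiv M n) μ (chiCube_coverCorner_eq_one_of_near_bbox R hM hw hlo hhi hS μ k)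

/-- ★★ `M_{χ̃_k∘e_μ⁻¹}∘M_{χ_k} = M_{χ̃_k∘e_μ⁻¹}` at the cover (files 44∕45's `hsb`; FILE II `bcube_comp_shift_symm_cut`). [folklore] -/
theorem bcube_cover_comp_shift_symm_cut (hM : ∀ ν, M ν = 2 * q * w) (hw : 0 < w) (hlo : R * w ≤ m₀) (hhi : (m₀ : ℝ) + w + (R + 1) * w + 1 ≤ S) (hS : S ≤ 2 * q * w)
    (k : Fin (d + 1) → ZMod (2 * q)) (μ : Fin (d + 1)) :
    mulOp (bcube (2 * q) (coverXi M n w) R k ∘ (bshiftEquiv M n μ).symm) ∘ₗ mulOp (chiCube M n (coverCorner M w q m₀ k) S) =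
      mulOp (bcube (2 * q) (coverXi M n w) R k ∘ (bshiftEquiv M n μ).symm) :=
  bcube_comp_shift_symm_cut (2 * q) (coverXi M n w) R (bshiftEquiv M n) μ (chiCube_coverCorner_eq_one_of_near_bbox R hM hw hlo hhi hS μ k)

/-- ★★ `M_{χ_k}∘M_{χ̃_k∘e_μ⁻¹} = M_{χ̃_k∘e_μ⁻¹}` at the cover (file 45's `hsb2`; FILE II `cut_bcube_comp_shift_symm`). [folklore] -/
theorem cut_bcube_cover_comp_shift_symm (hM : ∀ ν, M ν = 2 * q * w) (hw : 0 < w) (hlo : R * w ≤ m₀) (hhi : (m₀ : ℝ) + w + (R + 1) * w + 1 ≤ S) (hS : S ≤ 2 * q * w)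
    (k : Fin (d + 1) → ZMod (2 * q)) (μ : Fin (d + 1)) :
    mulOp (chiCube M n (coverCorner M w q m₀ k) S) ∘ₗ mulOp (bcube (2 * q) (coverXi M n w) R k ∘ (bshiftEquiv M n μ).symm) =
      mulOp (bcube (2 * q) (coverXi M n w) R k ∘ (bshiftEquiv M n μ).symm) :=
  cut_bcube_comp_shift_symm (2 * q) (coverXi M n w) R (bshiftEquiv M n) μ (chiCube_coverCorner_eq_one_of_near_bbox R hM hw hlo hhi hS μ k)

/-- ★★ `M_{∇_μχ̃_k}∘M_{χ_k} = M_{∇_μχ̃_k}` at the cover, any weight `a` (files 44∕45's `hdd`; FILE II `fgrad_bcube_cut`). [folklore] -/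
theorem fgrad_bcube_cover_cut (hM : ∀ ν, M ν = 2 * q * w) (hw : 0 < w) (hlo : R * w ≤ m₀) (hhi : (m₀ : ℝ) + w + (R + 1) * w + 1 ≤ S) (hS : S ≤ 2 * q * w) (a : ℝ)
    (k : Fin (d + 1) → ZMod (2 * q)) (μ : Fin (d + 1)) :
    mulOp (fgrad a (bshiftEquiv M n μ) (bcube (2 * q) (coverXi M n w) R k)) ∘ₗ mulOp (chiCube M n (coverCorner M w q m₀ k) S) =
      mulOp (fgrad a (bshiftEquiv M n μ) (bcube (2 * q) (coverXi M n w) R k)) :=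
  fgrad_bcube_cut (2 * q) (coverXi M n w) R (bshiftEquiv M n) μ a (chiCube_coverCorner_eq_one_of_near_bbox R hM hw hlo hhi hS μ k)

/-- ★★ `M_{χ_k}∘M_{∇_μχ̃_k} = M_{∇_μχ̃_k}` at the cover (file 45's `hdd2`; FILE II `cut_fgrad_bcube`). [folklore] -/
theorem cut_fgrad_bcube_cover (hM : ∀ ν, M ν = 2 * q * w) (hw : 0 < w) (hlo : R * w ≤ m₀) (hhi : (m₀ : ℝ) + w + (R + 1) * w + 1 ≤ S) (hS : S ≤ 2 * q * w) (a : ℝ)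
    (k : Fin (d + 1) → ZMod (2 * q)) (μ : Fin (d + 1)) :
    mulOp (chiCube M n (coverCorner M w q m₀ k) S) ∘ₗ mulOp (fgrad a (bshiftEquiv M n μ) (bcube (2 * q) (coverXi M n w) R k)) =
      mulOp (fgrad a (bshiftEquiv M n μ) (bcube (2 * q) (coverXi M n w) R k)) :=
  cut_fgrad_bcube (2 * q) (coverXi M n w) R (bshiftEquiv M n) μ a (chiCube_coverCorner_eq_one_of_near_bbox R hM hw hlo hhi hS μ k)

/-- ★★ `M_{∇⁻_μχ̃_k}∘M_{χ_k} = M_{∇⁻_μχ̃_k}` at the cover (files 44∕45's `hddb`; FILE II `bgrad_bcube_cut`). [folklore] -/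
theorem bgrad_bcube_cover_cut (hM : ∀ ν, M ν = 2 * q * w) (hw : 0 < w) (hlo : R * w ≤ m₀) (hhi : (m₀ : ℝ) + w + (R + 1) * w + 1 ≤ S) (hS : S ≤ 2 * q * w) (a : ℝ)
    (k : Fin (d + 1) → ZMod (2 * q)) (μ : Fin (d + 1)) :
    mulOp (bgrad a (bshiftEquiv M n μ) (bcube (2 * q) (coverXi M n w) R k)) ∘ₗ mulOp (chiCube M n (coverCorner M w q m₀ k) S) =
      mulOp (bgrad a (bshiftEquiv M n μ) (bcube (2 * q) (coverXi M n w) R k)) :=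
  bgrad_bcube_cut (2 * q) (coverXi M n w) R (bshiftEquiv M n) μ a (chiCube_coverCorner_eq_one_of_near_bbox R hM hw hlo hhi hS μ k)

/-- ★★ `M_{χ_k}∘M_{∇⁻_μχ̃_k} = M_{∇⁻_μχ̃_k}` at the cover (file 45's `hddb2`; FILE II `cut_bgrad_bcube`). [folklore] -/
theorem cut_bgrad_bcube_cover (hM : ∀ ν, M ν = 2 * q * w) (hw : 0 < w) (hlo : R * w ≤ m₀) (hhi : (m₀ : ℝ) + w + (R + 1) * w + 1 ≤ S) (hS : S ≤ 2 * q * w) (a : ℝ)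
    (k : Fin (d + 1) → ZMod (2 * q)) (μ : Fin (d + 1)) :
    mulOp (chiCube M n (coverCorner M w q m₀ k) S) ∘ₗ mulOp (bgrad a (bshiftEquiv M n μ) (bcube (2 * q) (coverXi M n w) R k)) =
      mulOp (bgrad a (bshiftEquiv M n μ) (bcube (2 * q) (coverXi M n w) R k)) :=
  cut_bgrad_bcube (2 * q) (coverXi M n w) R (bshiftEquiv M n) μ a (chiCube_coverCorner_eq_one_of_near_bbox R hM hw hlo hhi hS μ k)

end Cut

/-! ## §4 The plateau identity `hL` at the cover -/

section Plateau

variable {M : Fin (d + 1) → ℕ} [∀ μ, NeZero (M μ)] {n w q : ℕ} [NeZero n] (R : ℝ)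

omit [∀ μ, NeZero (M μ)] in
/-- the cover's shift step is at most one block: `(nw)⁻¹ ≤ 1`, so `R ≥ 2` implies the plateau radius condition `R ≥ 1 + (nw)⁻¹`. [folklore] -/
theorem one_add_inv_le_of_two_le (hw : 0 < w) (hR : 2 ≤ R) : 1 + |((n : ℝ) * w)⁻¹| ≤ R := by
  have hn : 1 ≤ n := Nat.one_le_iff_ne_zero.mpr (NeZero.ne n)
  have h1 : (1 : ℝ) ≤ (n : ℝ) * w := by
    have : (1 : ℝ) ≤ n := by exact_mod_cast hn
    have : (1 : ℝ) ≤ w := by exact_mod_cast hw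
    nlinarith
  rw [abs_of_nonneg (by positivity)]
  linarith [inv_le_one_of_one_le₀ h1]

/-- ★★ **THE PLATEAU COVERS THE PARTITION CELL AND ITS NEIGHBOURS, AT THE COVER**: `R ≥ 1 + (nw)⁻¹` ⟹ `h_k(x) ≠ 0 ⟹ χ̃_k(x₀) = 1` for `x₀ ∈ {x, x + e_μ, x − e_μ}`
(FILE II `bcube_eq_one_of_hcube_ne_zero` with FILE 66 `coverXi_shift`). [cite: Balaban1984PropagatorsII, (2.36) p.229, (2.91) p.239 (mechanism)] -/
theorem bcube_cover_eq_one_of_coverH_ne_zero (hM : ∀ ν, M ν = 2 * q * w) (hw : 0 < w) (hR : 1 + |((n : ℝ) * w)⁻¹| ≤ R) {k : Fin (d + 1) → ZMod (2 * q)} (μ : Fin (d + 1))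
    {x x₀ : Tor (fine n M) × Fin (d + 1)} (hx₀ : x₀ = x ∨ x₀ = bshiftEquiv M n μ x ∨ x₀ = (bshiftEquiv M n μ).symm x) (hne : hcube (2 * q) (coverXi M n w) k x ≠ 0) :
    bcube (2 * q) (coverXi M n w) R k x₀ = 1 :=
  bcube_eq_one_of_hcube_ne_zero (2 * q) (coverXi M n w) R (bshiftEquiv M n) (two_mul_q_pos_of_cover hM) (coverXi_shift hM hw) hR μ hx₀ hne

/-- ★ the same with the uniform radius condition `R ≥ 2`. [cite: Balaban1984PropagatorsII, (2.91) p.239 (mechanism)] -/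
theorem bcube_cover_eq_one_of_coverH_ne_zero_two (hM : ∀ ν, M ν = 2 * q * w) (hw : 0 < w) (hR : 2 ≤ R) {k : Fin (d + 1) → ZMod (2 * q)} (μ : Fin (d + 1))
    {x x₀ : Tor (fine n M) × Fin (d + 1)} (hx₀ : x₀ = x ∨ x₀ = bshiftEquiv M n μ x ∨ x₀ = (bshiftEquiv M n μ).symm x) (hne : hcube (2 * q) (coverXi M n w) k x ≠ 0) :
    bcube (2 * q) (coverXi M n w) R k x₀ = 1 :=
  bcube_cover_eq_one_of_coverH_ne_zero R hM hw (one_add_inv_le_of_two_le R hw hR) μ hx₀ hne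

/-- ★★★ **files 44∕45's `hL` AT THE COVER**: `R ≥ 1 + (nw)⁻¹` and the displayed locality `M_{h_k}∘W∘M_{1−χ̃_k} = 0` of the potential part ⟹
`M_{h_k}∘lapOp n (bshiftEquiv M n) W∘M_{1−χ̃_k} = 0` (FILE II `mulOp_hcube_comp_lapOp_comp_one_sub_bcube`). [cite: Balaban1984PropagatorsII, (2.91) p.239 (mechanism); Balaban1985BackgroundPropagators, (3.26) p.395, (3.62)–(3.65) pp.402–403 (shape)] -/
theorem mulOp_coverH_comp_lapOp_comp_one_sub_bcube_cover (hM : ∀ ν, M ν = 2 * q * w) (hw : 0 < w) (hR : 1 + |((n : ℝ) * w)⁻¹| ≤ R) (a : ℝ)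
    (W : (Tor (fine n M) × Fin (d + 1) → ℝ) →ₗ[ℝ] (Tor (fine n M) × Fin (d + 1) → ℝ)) (k : Fin (d + 1) → ZMod (2 * q))
    (hW : mulOp (hcube (2 * q) (coverXi M n w) k) ∘ₗ W ∘ₗ mulOp (1 - bcube (2 * q) (coverXi M n w) R k) = 0) :
    mulOp (hcube (2 * q) (coverXi M n w) k) ∘ₗ lapOp a (bshiftEquiv M n) W ∘ₗ mulOp (1 - bcube (2 * q) (coverXi M n w) R k) = 0 :=
  mulOp_hcube_comp_lapOp_comp_one_sub_bcube (2 * q) (coverXi M n w) R (bshiftEquiv M n) (two_mul_q_pos_of_cover hM) (coverXi_shift hM hw) hR a W k hW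

/-- ★★ the same with `R ≥ 2`. [cite: Balaban1984PropagatorsII, (2.91) p.239 (mechanism)] -/
theorem mulOp_coverH_comp_lapOp_comp_one_sub_bcube_cover_two (hM : ∀ ν, M ν = 2 * q * w) (hw : 0 < w) (hR : 2 ≤ R) (a : ℝ)
    (W : (Tor (fine n M) × Fin (d + 1) → ℝ) →ₗ[ℝ] (Tor (fine n M) × Fin (d + 1) → ℝ)) (k : Fin (d + 1) → ZMod (2 * q))
    (hW : mulOp (hcube (2 * q) (coverXi M n w) k) ∘ₗ W ∘ₗ mulOp (1 - bcube (2 * q) (coverXi M n w) R k) = 0) :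
    mulOp (hcube (2 * q) (coverXi M n w) k) ∘ₗ lapOp a (bshiftEquiv M n) W ∘ₗ mulOp (1 - bcube (2 * q) (coverXi M n w) R k) = 0 :=
  mulOp_coverH_comp_lapOp_comp_one_sub_bcube_cover R hM hw (one_add_inv_le_of_two_le R hw hR) a W k hW

/-- ★★ **`hL` HYPOTHESIS-FREE FOR A MULTIPLICATION OPERATOR**: `R ≥ 1 + (nw)⁻¹` ⟹ `M_{h_k}∘(Σ_μ∇*_μ∇_μ + M_v)∘M_{1−χ̃_k} = 0` at the cover (FILE II
`mulOp_hcube_comp_lapOp_mulOp_comp_one_sub_bcube`). [cite: Balaban1985BackgroundPropagators, (3.26) p.395 (shape)] -/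
theorem mulOp_coverH_comp_lapOp_mulOp_comp_one_sub_bcube_cover (hM : ∀ ν, M ν = 2 * q * w) (hw : 0 < w) (hR : 1 + |((n : ℝ) * w)⁻¹| ≤ R) (a : ℝ)
    (v : Tor (fine n M) × Fin (d + 1) → ℝ) (k : Fin (d + 1) → ZMod (2 * q)) :
    mulOp (hcube (2 * q) (coverXi M n w) k) ∘ₗ lapOp a (bshiftEquiv M n) (mulOp v) ∘ₗ mulOp (1 - bcube (2 * q) (coverXi M n w) R k) = 0 :=
  mulOp_hcube_comp_lapOp_mulOp_comp_one_sub_bcube (2 * q) (coverXi M n w) R (bshiftEquiv M n) (two_mul_q_pos_of_cover hM) (coverXi_shift hM hw) hR a v k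

end Plateau

end Summit.QuantumFields.YangMills.BalabanUVNodes.N15.Gluing

end
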